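import Literature.IUT.HodgeTheaters.GlobalFrobenioidsCoricRigidityFieldLevel
import Mathlib.FieldTheory.Galois.Profinite
import Mathlib.FieldTheory.Galois.Infinite
import Mathlib.FieldTheory.IsAlgClosed.AlgebraicClosure
import Mathlib.FieldTheory.IsSepClosed
import Mathlib.FieldTheory.RatFunc.AsPolynomial
import Mathlib.RingTheory.RootsOfUnity.AlgebraicallyClosed
import Mathlib.Analysis.SpecialFunctions.Pow.Real
import HarnessLib

/-!
# [IUTchI] Example 5.1 (v): law (iv) of the field-level closer is INDEPENDENT of the other seven hypotheses — and
# load-bearing (independence model; proof-only)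

S. Mochizuki, *Inter-universal Teichmüller theory I*, kurims manuscript (May 2020), §5 Example 5.1 (v), p. 128 l. 49–54
([IUTchI] Ex 5.1 (v) p.128) [claim: Mochizuki2012, status: disputed]: "`†ℱ^⊛` always admits an ∞κ-coric (respectively,
∞κ×-coric) structure, which is, moreover, unique up to a uniquely determined isomorphism"; the uniqueness rests (p. 127
l. 75 – p. 128 l. 24) on the Kummer injection `†𝕄^⊛_∞κ ↪ lim_H H¹(H, μ_Ẑ(†𝕄^⊛_∞κ))`, `Aut(μ_Ẑ) = Ẑ^×`, "`ℚ_{>0} ∩ Ẑ^× = {1}`"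
and Remark 3.1.7 (i)/(ii) (p. 67).  LANA §6.1 pp. 31–32 [LANA2026Report].  Sub-DAG `plan/L5/SUBDAG-IUTchI-Ex51.md` rows
E51/L26, E51/L29; node IUTchI:Ex5.1(v); CERT-L5 v0.5 item (i) `layer5_held_ex51v_v5_fieldLevel` (p439054), whose closer is
abc-iut-w4-d056's `NFBridgeRecon.existsUniqueCoricStructure_infκPair_fieldLevel` (p436822).  PROOF-ONLY: no definition, no
instance, no new `Prop` fact; every object is built inside the proofs.

**What is proved.**  The closer p436822 derives `ExistsUniqueCoricStructure π₁^rat 𝕄^⊛_∞κ` from EIGHT elementary statements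
about `K_rat` with its `π₁^rat`-action: side-conditions `hroot hprim h1 hpow` and laws (iv) `hdiv` (Kummer injectivity at the
finite levels: no `H`-invariant `a ≠ 1` has `H`-invariant roots of every order, `H` open normal), (o) `hordmul`, Rmk 3.1.7 (i)
`hpole`, Rmk 3.1.7 (ii) `hex`.  `exists_fieldLevel_laws_sans_div_not_existsUniqueCoricStructure`: there are an instance `N` of
abc-iut-L5-t1's Example 5.1 (i) interface and order maps `ord : Fin 2 → K_rat → ℤ` at which the SEVEN hypotheses other than
(iv) hold VERBATIM (v0.5 shapes, `hpole` even on `𝕄^⊛_∞κ×`), `MκIsInvariants` holds, and `ExistsUniqueCoricStructure` FAILS for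
BOTH model pairs — hence (by p436822 itself) (iv) fails there.  `not_fieldLevel_sans_div`: the closer with (iv) deleted is
FALSE as a schema.  So (iv) is not implied by the other seven; it is the hypothesis through which the ARITHMETIC of the
constant field enters.

**The model** (honest label: a TIGHTNESS MODEL of our typed hypotheses — not print's `Gal(L̄_C/L_C)`-datum, nothing of print
is formalised by it, not a discharge, no census/token change).  `K_rat := K̄`, an algebraic closure of `ℝ(t)`;
`π₁^rat := Gal(K̄/ℝ(t))`, Krull topology — a genuine infinite profinite Galois group (Mathlib `InfiniteGalois`: open stabilisers
by `IntermediateField.fixingSubgroup_isOpen`, fixed field `ℝ(t)` by `InfiniteGalois.mem_range_algebraMap_iff_fixed`);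
`𝕄^⊛_∞κ = 𝕄^⊛_∞κ× := {f | fⁿ = 2^a · s^m, n ≥ 1, a ∈ ℤ, m ∈ ℕ}` (radical closure of `2^ℤ · s^ℕ`, `s := t (t − 1)`); `𝕄^⊛_κ :=` its
invariant part; `ord₀, ord₁ :=` orders at `t = 0, 1` of the `ℝ(t)`-representative.  The model pair carries the NON-TRIVIAL
automorphism `e : f ↦ 2^{deg_s f} · f` (`deg_s f := m/n ∈ ℚ`, well defined via `ord₀`; `2^q` the positive real power, fixed by
`π₁^rat`): equivariant, multiplicative, bijective, `e(s) = 2s ≠ s`.  Law (iv) fails visibly: `2` is invariant with invariant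
roots `2^{1/n}` of every order.  **Reading** (NODES IUTchI:Ex5.1(v) / SUBDAG E51/L26; no side taken): in print the constant field
of `L_C` is a NUMBER FIELD, which has no infinitely divisible element `≠ 1` — the content of (iv); over a constant field with such
an element (`ℝ`, `ℂ`, `ℚ̄`) the boxed uniqueness is false for a radical-closure pseudo-monoid although Rmk 3.1.7 (i)/(ii), rootability and the
valuation law hold.  Companions: abc-iut-w5-d110's `not_fieldLevel_laws_of_finite` (`…FieldLevelTightness.lean`: no model with
FINITE `π₁^rat`); abc-iut-w4-d050's `exists_fieldLevel_laws` (`…CoricFieldLevelNonVacuity.lean`: all eight jointly inhabited at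
`Gal(ℚ̄/ℚ) ↷ ℚ̄`).  inhabited ≠ discharged; typed ≠ proved; nothing here asserts abc proved or refuted or takes a side on Cor. 3.12.
-/

namespace Literature.IUT.HodgeTheaters

open Polynomial

namespace NFBridgeRecon

/-! ### Orders of rational functions at a point (explicit expressions; no definitions) -/

section RatFuncOrders

variable {K : Type*} [Field K]

/-- Additivity of `ord_a := rootMultiplicity_a(num) − rootMultiplicity_a(denom)` on nonzero rational functions (the valuation
law (o) of the model). ([IUTchI] Ex 5.1 (v) p.128) [claim: Mochizuki2012, status: disputed] -/
theorem ratFunc_ord_mul (a : K) {x y : RatFunc K} (hx : x ≠ 0) (hy : y ≠ 0) :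
    ((x * y).num.rootMultiplicity a : ℤ) - (x * y).denom.rootMultiplicity a =
      ((x.num.rootMultiplicity a : ℤ) - x.denom.rootMultiplicity a) +
        ((y.num.rootMultiplicity a : ℤ) - y.denom.rootMultiplicity a) := by
  have h := RatFunc.num_denom_mul x y
  have hxy : x * y ≠ 0 := mul_ne_zero hx hy
  have h1 : (x * y).num * (x.denom * y.denom) ≠ 0 :=
    mul_ne_zero (RatFunc.num_ne_zero hxy) (mul_ne_zero (RatFunc.denom_ne_zero x) (RatFunc.denom_ne_zero y))
  have h2 : x.num * y.num * (x * y).denom ≠ 0 :=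
    mul_ne_zero (mul_ne_zero (RatFunc.num_ne_zero hx) (RatFunc.num_ne_zero hy)) (RatFunc.denom_ne_zero _)
  have := congrArg (Polynomial.rootMultiplicity a) h
  rw [rootMultiplicity_mul h1, rootMultiplicity_mul (mul_ne_zero (RatFunc.denom_ne_zero x) (RatFunc.denom_ne_zero y)),
    rootMultiplicity_mul h2, rootMultiplicity_mul (mul_ne_zero (RatFunc.num_ne_zero hx) (RatFunc.num_ne_zero hy))] at this
  omega

/-- `ord_a (xⁿ) = n · ord_a x`, `x ≠ 0`. ([IUTchI] Ex 5.1 (v) p.128) [claim: Mochizuki2012, status: disputed] -/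
theorem ratFunc_ord_pow (a : K) {x : RatFunc K} (hx : x ≠ 0) (n : ℕ) :
    ((x ^ n).num.rootMultiplicity a : ℤ) - (x ^ n).denom.rootMultiplicity a =
      n * ((x.num.rootMultiplicity a : ℤ) - x.denom.rootMultiplicity a) := by
  induction n with
  | zero => simp
  | succ n ih =>
    rw [pow_succ, ratFunc_ord_mul a (pow_ne_zero n hx) hx, ih]
    push_cast
    ring

/-- `ord_a` of a polynomial is its root multiplicity at `a`. ([IUTchI] Ex 5.1 (v) p.128) [claim: Mochizuki2012, status: disputed] -/
theorem ratFunc_ord_algebraMap (a : K) (p : K[X]) :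
    ((algebraMap K[X] (RatFunc K) p).num.rootMultiplicity a : ℤ) -
        (algebraMap K[X] (RatFunc K) p).denom.rootMultiplicity a = p.rootMultiplicity a := by
  rw [RatFunc.num_algebraMap, RatFunc.denom_algebraMap]
  simp

/-- `s = t (t − 1)` has a simple zero at `t = 0` and at `t = 1` ("at least two distinct zeroes", Rmk 3.1.7 (ii)).
([IUTchI] Ex 5.1 (v) p.128) [claim: Mochizuki2012, status: disputed] -/
theorem rootMultiplicity_X_mul_X_sub_one [DecidableEq K] (a : K) :
    (X * (X - C 1) : K[X]).rootMultiplicity a = (if a = 0 then 1 else 0) + (if a = 1 then 1 else 0) := by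
  have hne : (X * (X - C 1) : K[X]) ≠ 0 := mul_ne_zero X_ne_zero (X_sub_C_ne_zero 1)
  have h0 : (X : K[X]).rootMultiplicity a = if a = 0 then 1 else 0 := by
    rw [show (X : K[X]) = X - C 0 by simp, rootMultiplicity_X_sub_C]
  rw [rootMultiplicity_mul hne, h0, rootMultiplicity_X_sub_C]

/-- `ord_a (2^k · s^m) = m` at `a = 0` and at `a = 1`. ([IUTchI] Ex 5.1 (v) p.128) [claim: Mochizuki2012, status: disputed] -/
theorem ratFunc_ord_generator [DecidableEq K] [NeZero (2 : K)] (a : K) (k : ℤ) (m : ℕ) :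
    ((((RatFunc.C (2 : K)) ^ k * (algebraMap K[X] (RatFunc K) (X * (X - C 1))) ^ m).num.rootMultiplicity a : ℤ) -
        ((RatFunc.C (2 : K)) ^ k * (algebraMap K[X] (RatFunc K) (X * (X - C 1))) ^ m).denom.rootMultiplicity a) =
      m * ((if a = 0 then 1 else 0) + (if a = 1 then 1 else 0) : ℕ) := by
  have hs : algebraMap K[X] (RatFunc K) (X * (X - C 1)) ≠ 0 :=
    (map_ne_zero_iff _ (IsFractionRing.injective K[X] (RatFunc K))).mpr (mul_ne_zero X_ne_zero (X_sub_C_ne_zero 1))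
  have hc : (RatFunc.C (2 : K)) ^ k ≠ 0 := zpow_ne_zero k ((_root_.map_ne_zero RatFunc.C).mpr (NeZero.ne 2))
  rw [ratFunc_ord_mul a hc (pow_ne_zero m hs), ratFunc_ord_pow a hs m, ratFunc_ord_algebraMap, rootMultiplicity_X_mul_X_sub_one,
    ← map_zpow₀ RatFunc.C (2 : K) k, RatFunc.num_C, RatFunc.denom_C, rootMultiplicity_C]
  simp

end RatFuncOrders

/-- Well-definedness of the `s`-degree `m/n` of an element `f` with `fⁿ = 2^a · s^m` (compare orders at `t = 0`).
([IUTchI] Ex 5.1 (v) p.128) [claim: Mochizuki2012, status: disputed] -/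
theorem sDegree_wellDefined {L : Type*} [Field L] [Algebra (RatFunc ℝ) L] {f : L} {n n' : ℕ} {a a' : ℤ} {m m' : ℕ}
    (h : f ^ n = algebraMap (RatFunc ℝ) L
      ((RatFunc.C (2 : ℝ)) ^ a * (algebraMap ℝ[X] (RatFunc ℝ) (X * (X - C 1))) ^ m))
    (h' : f ^ n' = algebraMap (RatFunc ℝ) L
      ((RatFunc.C (2 : ℝ)) ^ a' * (algebraMap ℝ[X] (RatFunc ℝ) (X * (X - C 1))) ^ m')) :
    (m : ℤ) * n' = (m' : ℤ) * n := by
  have hs : algebraMap ℝ[X] (RatFunc ℝ) (X * (X - C 1)) ≠ 0 :=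
    (map_ne_zero_iff _ (IsFractionRing.injective ℝ[X] (RatFunc ℝ))).mpr (mul_ne_zero X_ne_zero (X_sub_C_ne_zero 1))
  have hc : ∀ k : ℤ, (RatFunc.C (2 : ℝ)) ^ k ≠ 0 := fun k =>
    zpow_ne_zero k ((_root_.map_ne_zero RatFunc.C).mpr (NeZero.ne 2))
  have hA : ((RatFunc.C (2 : ℝ)) ^ a * (algebraMap ℝ[X] (RatFunc ℝ) (X * (X - C 1))) ^ m) ^ n' =
      ((RatFunc.C (2 : ℝ)) ^ a' * (algebraMap ℝ[X] (RatFunc ℝ) (X * (X - C 1))) ^ m') ^ n := by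
    apply (algebraMap (RatFunc ℝ) L).injective
    rw [map_pow, map_pow, ← h, ← h', ← pow_mul, ← pow_mul, mul_comm]
  have key := ratFunc_ord_pow 0 (mul_ne_zero (hc a) (pow_ne_zero m hs)) n'
  rw [hA, ratFunc_ord_pow 0 (mul_ne_zero (hc a') (pow_ne_zero m' hs)), ratFunc_ord_generator,
    ratFunc_ord_generator] at key
  simp only [if_true, zero_ne_one, if_false, add_zero, Nat.cast_one, mul_one] at key
  linarith

/-- **[IUTchI] Ex. 5.1 (v) — law (iv) of the field-level closer is LOAD-BEARING (tightness model).**  An instance `N` of the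
Example 5.1 (i) interface (`π₁^rat := Gal(K̄/ℝ(t)) ↷ K_rat := K̄`; `𝕄^⊛_∞κ = 𝕄^⊛_∞κ× :=` radical closure of `2^ℤ · (t(t−1))^ℕ`;
`𝕄^⊛_κ :=` its invariant part) with `ord₀, ord₁ :=` orders at `t = 0, 1`, at which — VERBATIM in the shapes of p436822 / CERT-L5
v0.5 item (i) — `hroot hprim h1 hpow`, (o) `hordmul`, Rmk 3.1.7 (i) `hpole` (on `𝕄^⊛_∞κ×`), (ii) `hex` HOLD, `MκIsInvariants` holds,
yet `ExistsUniqueCoricStructure` FAILS for both model pairs (automorphism `f ↦ 2^{deg_s f} · f`), so that law (iv) `hdiv` FAILS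
(last conjunct, from p436822 by contraposition).  Tightness model of OUR typed hypotheses; not print's datum; not a discharge.
([IUTchI] Ex 5.1 (v) p.128) [claim: Mochizuki2012, status: disputed] -/
theorem exists_fieldLevel_laws_sans_div_not_existsUniqueCoricStructure :
    ∃ (N : NFBridgeRecon.{0}) (ord : Fin 2 → N.Krat → ℤ),
      (∀ a : N.Krat, a ≠ 0 → ∀ n : ℕ, 0 < n → ∃ b : N.Krat, b ^ n = a) ∧
      (∀ n : ℕ, 0 < n → ∃ ζ : N.Krat, IsPrimitiveRoot ζ n) ∧
      (1 : N.Krat) ∈ N.Minfκ ∧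
      (∀ (f : N.Krat) (n : ℕ), 0 < n → (f ∈ N.Minfκ ↔ f ^ n ∈ N.Minfκ)) ∧
      (∀ (x : Fin 2) (a b : N.Krat), a ≠ 0 → b ≠ 0 → (∀ g : N.piRat, g • a = a) → (∀ g : N.piRat, g • b = b) →
        ord x (a * b) = ord x a + ord x b) ∧
      (∀ f' ∈ N.Minfκx, (∀ g : N.piRat, g • f' = f') →
        ∀ x₁ x₂ : Fin 2, x₁ ≠ x₂ → ¬ (ord x₁ f' < 0 ∧ ord x₂ f' < 0)) ∧
      (∃ f ∈ N.Minfκ, (∀ g : N.piRat, g • f = f) ∧ ∃ x₁ x₂ : Fin 2, x₁ ≠ x₂ ∧ 0 < ord x₁ f ∧ 0 < ord x₂ f) ∧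
      N.MκIsInvariants ∧
      ¬ ExistsUniqueCoricStructure N.piRat N.infκPair ∧
      ¬ ExistsUniqueCoricStructure N.piRat N.infκxPair ∧
      ¬ (∀ (H : OpenNormalSubgroup N.piRat) (a : N.Krat), a ≠ 0 → (∀ h : N.piRat, h ∈ H → h • a = a) →
          (∀ n : ℕ+, ∃ b : N.Krat, (∀ h : N.piRat, h ∈ H → h • b = b) ∧ b ^ (n : ℕ) = a) → a = 1) := by
  classical
  -- (1) the field `K̄ ⊇ ℝ(t)` and its absolute Galois group, a profinite group acting smoothly
  let Kb : Type := AlgebraicClosure (RatFunc ℝ)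
  let Γ : ProfiniteGrp.{0} := ProfiniteGrp.of (Kb ≃ₐ[RatFunc ℝ] Kb)
  letI act : MulSemiringAction Γ Kb := inferInstanceAs (MulSemiringAction (Kb ≃ₐ[RatFunc ℝ] Kb) Kb)
  have hstab : ∀ f : Kb, IsOpen (MulAction.stabilizer Γ f : Set Γ) := by
    intro f
    have hint : IsIntegral (RatFunc ℝ) f := (Algebra.IsAlgebraic.isAlgebraic f).isIntegral
    haveI : FiniteDimensional (RatFunc ℝ) (IntermediateField.adjoin (RatFunc ℝ) {f}) :=
      IntermediateField.adjoin.finiteDimensional hint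
    refine Subgroup.isOpen_mono ?_ ((IntermediateField.adjoin (RatFunc ℝ) {f}).fixingSubgroup_isOpen (L := Kb))
    intro σ hσ
    exact MulAction.mem_stabilizer_iff.mpr
      ((IntermediateField.mem_fixingSubgroup_iff _ _).mp hσ f (IntermediateField.mem_adjoin_simple_self (RatFunc ℝ) f))
  let ι : RatFunc ℝ →+* Kb := algebraMap (RatFunc ℝ) Kb
  have hι : Function.Injective ι := (algebraMap (RatFunc ℝ) Kb).injective
  have hfix : ∀ f : Kb, (∀ g : Γ, g • f = f) → ∃ r : RatFunc ℝ, ι r = f := fun f hf =>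
    (InfiniteGalois.mem_range_algebraMap_iff_fixed f).mpr hf
  have hsmul_alg : ∀ (g : Γ) (r : RatFunc ℝ), g • ι r = ι r := fun g r =>
    AlgEquiv.commutes (show Kb ≃ₐ[RatFunc ℝ] Kb from g) r
  -- (2) the generating monoid `2^ℤ · s^ℕ`, `s = t (t - 1)`, and its radical closure `M`
  let s : RatFunc ℝ := algebraMap ℝ[X] (RatFunc ℝ) (X * (X - C 1))
  have hs : s ≠ 0 :=
    (map_ne_zero_iff _ (IsFractionRing.injective ℝ[X] (RatFunc ℝ))).mpr (mul_ne_zero X_ne_zero (X_sub_C_ne_zero 1))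
  have h2 : RatFunc.C (2 : ℝ) ≠ 0 := (_root_.map_ne_zero RatFunc.C).mpr two_ne_zero
  have gen_ne : ∀ (a : ℤ) (m : ℕ), ι ((RatFunc.C 2) ^ a * s ^ m) ≠ 0 := fun a m =>
    (_root_.map_ne_zero ι).mpr (mul_ne_zero (zpow_ne_zero a h2) (pow_ne_zero m hs))
  let M : Set Kb := {f | ∃ (n : ℕ) (a : ℤ) (m : ℕ), 0 < n ∧ f ^ n = ι ((RatFunc.C 2) ^ a * s ^ m)}
  have one_mem : (1 : Kb) ∈ M := ⟨1, 0, 0, one_pos, by simp⟩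
  have zero_notMem : (0 : Kb) ∉ M := fun ⟨n, a, m, hn, h⟩ => gen_ne a m (by rw [← h, zero_pow hn.ne'])
  have smul_memM : ∀ (g : Γ) {f : Kb}, f ∈ M → g • f ∈ M := fun g f ⟨n, a, m, hn, h⟩ =>
    ⟨n, a, m, hn, by rw [← smul_pow', h, hsmul_alg]⟩
  have mul_memM : ∀ {f f' : Kb}, f ∈ M → f' ∈ M → f * f' ∈ M := by
    rintro f f' ⟨n, a, m, hn, h⟩ ⟨n', a', m', hn', h'⟩
    refine ⟨n * n', a * n' + a' * n, m * n' + m' * n, mul_pos hn hn', ?_⟩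
    rw [mul_pow, pow_mul, h, mul_comm n n', pow_mul, h', ← map_pow ι, ← map_pow ι, ← map_mul ι]
    congr 1
    rw [mul_pow, mul_pow, ← zpow_natCast ((RatFunc.C (2:ℝ)) ^ a), ← zpow_natCast ((RatFunc.C (2:ℝ)) ^ a'),
      ← zpow_mul, ← zpow_mul, zpow_add₀ h2, pow_add, pow_mul, pow_mul]
    ring
  have pow_iffM : ∀ (f : Kb) (k : ℕ), 0 < k → (f ∈ M ↔ f ^ k ∈ M) := by
    intro f k hk
    constructor
    · rintro ⟨n, a, m, hn, h⟩
      refine ⟨n, a * k, m * k, hn, ?_⟩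
      rw [← pow_mul, mul_comm, pow_mul, h, ← map_pow ι]
      congr 1
      rw [mul_pow, ← zpow_natCast ((RatFunc.C (2:ℝ)) ^ a), ← zpow_mul, ← pow_mul]
    · rintro ⟨n, a, m, hn, h⟩
      exact ⟨k * n, a, m, mul_pos hk hn, by rw [pow_mul, h]⟩
  -- (3) the interface instance
  let N : NFBridgeRecon.{0} :=
    { l := 5, piDast := Γ, piDcirc := ⊤, Fbar := Kb, fbarAction := act, isOpen_stabilizer_fbar := hstab, piRat := Γ,
      ratToAst := ContinuousMonoidHom.id Γ, ratToAst_surjective := Function.surjective_id, Krat := Kb, kratAction := act,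
      isOpen_stabilizer_krat := hstab, const := RingHom.id Kb, const_smul := fun _ _ => rfl,
      Mκ := {f | f ∈ M ∧ ∀ g : Γ, g • f = f}, Minfκ := M, Minfκx := M, mκ_subset := fun _ hf => hf.1,
      minfκ_subset := subset_rfl, zero_notMem := zero_notMem, smul_mem_minfκ := fun g _ hf => smul_memM g hf,
      smul_mem_minfκx := fun g _ hf => smul_memM g hf, solKer := ⊥, solKer_normal := inferInstance, AutD := PUnit,
      Autε := ⊤, AutSL := ⊤, AutSLε := ⊤, autSLε_le := le_rfl, autSLε_le_autε := le_rfl, lift := fun _ => ContinuousMulEquiv.refl Γ }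
  -- (4) the order maps at `t = 0` and `t = 1`
  let pt : Fin 2 → ℝ := fun i => ((i : ℕ) : ℝ)
  let ord : Fin 2 → Kb → ℤ := fun i f =>
    if h : ∃ r : RatFunc ℝ, ι r = f then
      ((Classical.choose h).num.rootMultiplicity (pt i) : ℤ) - (Classical.choose h).denom.rootMultiplicity (pt i)
    else 0
  have ord_eval : ∀ (i : Fin 2) (r : RatFunc ℝ),
      ord i (ι r) = (r.num.rootMultiplicity (pt i) : ℤ) - r.denom.rootMultiplicity (pt i) := by
    intro i r
    have h : ∃ r' : RatFunc ℝ, ι r' = ι r := ⟨r, rfl⟩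
    have hc : Classical.choose h = r := hι (Classical.choose_spec h)
    simp only [ord, dif_pos h, hc]
  -- (5) the seven hypotheses
  have hroot : ∀ a : N.Krat, a ≠ 0 → ∀ n : ℕ, 0 < n → ∃ b : N.Krat, b ^ n = a := fun a _ n hn =>
    IsAlgClosed.exists_pow_nat_eq a hn
  have hprim : ∀ n : ℕ, 0 < n → ∃ ζ : N.Krat, IsPrimitiveRoot ζ n := fun n hn => by
    haveI : NeZero (n : Kb) := ⟨Nat.cast_ne_zero.mpr hn.ne'⟩; exact HasEnoughRootsOfUnity.prim
  have h1 : (1 : N.Krat) ∈ N.Minfκ := one_mem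
  have hpow : ∀ (f : N.Krat) (n : ℕ), 0 < n → (f ∈ N.Minfκ ↔ f ^ n ∈ N.Minfκ) := pow_iffM
  have hordmul : ∀ (x : Fin 2) (a b : N.Krat), a ≠ 0 → b ≠ 0 → (∀ g : N.piRat, g • a = a) →
      (∀ g : N.piRat, g • b = b) → ord x (a * b) = ord x a + ord x b := by
    intro x a b ha hb hfa hfb
    obtain ⟨r, rfl⟩ := hfix a hfa; obtain ⟨r', rfl⟩ := hfix b hfb
    rw [← map_mul, ord_eval, ord_eval, ord_eval]
    exact ratFunc_ord_mul (pt x) (fun h => ha (by rw [h, map_zero])) (fun h => hb (by rw [h, map_zero]))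
  have hpole : ∀ f' ∈ N.Minfκx, (∀ g : N.piRat, g • f' = f') →
      ∀ x₁ x₂ : Fin 2, x₁ ≠ x₂ → ¬ (ord x₁ f' < 0 ∧ ord x₂ f' < 0) := by
    rintro f' ⟨n, a, m, hn, h⟩ hfix' x₁ x₂ _ ⟨hlt, -⟩
    obtain ⟨r, rfl⟩ := hfix f' hfix'
    have hr : r ≠ 0 := fun h0 => gen_ne a m (by rw [← h, h0, map_zero, zero_pow hn.ne'])
    have hrn : r ^ n = (RatFunc.C 2) ^ a * s ^ m := hι (by rw [map_pow, h])
    have key := ratFunc_ord_pow (pt x₁) hr n  -- `m · (non-negative) = n · ord_{x₁} r` with `n > 0`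
    rw [hrn, ratFunc_ord_generator, ← ord_eval] at key
    have hnn : (0 : ℤ) ≤ n * ord x₁ (ι r) := by rw [← key]; positivity
    have : (0 : ℤ) ≤ ord x₁ (ι r) := nonneg_of_mul_nonneg_right hnn (by exact_mod_cast hn)
    exact absurd hlt (not_lt.mpr this)
  have s_mem : ι s ∈ M := ⟨1, 0, 1, one_pos, by simp⟩
  have hex : ∃ f ∈ N.Minfκ, (∀ g : N.piRat, g • f = f) ∧ ∃ x₁ x₂ : Fin 2, x₁ ≠ x₂ ∧ 0 < ord x₁ f ∧ 0 < ord x₂ f := by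
    refine ⟨ι s, s_mem, fun g => hsmul_alg g s, 0, 1, Fin.zero_ne_one, ?_, ?_⟩ <;>
      · rw [ord_eval, ratFunc_ord_algebraMap, rootMultiplicity_X_mul_X_sub_one]; simp [pt]
  have hMκ : N.MκIsInvariants := ⟨rfl⟩
  -- (6) the non-trivial automorphism `f ↦ 2^{deg_s f} · f` of the model ∞κ-pair
  have hmemM : ∀ x : N.infκPair.carrier, (x : Kb) ∈ M := fun x => x.2
  let n₀ : N.infκPair.carrier → ℕ := fun x => (hmemM x).choose
  let a₀ : N.infκPair.carrier → ℤ := fun x => (hmemM x).choose_spec.choose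
  let m₀ : N.infκPair.carrier → ℕ := fun x => (hmemM x).choose_spec.choose_spec.choose
  have rep₀ : ∀ x : N.infκPair.carrier, 0 < n₀ x ∧ (x : Kb) ^ n₀ x = ι ((RatFunc.C 2) ^ a₀ x * s ^ m₀ x) :=
    fun x => (hmemM x).choose_spec.choose_spec.choose_spec
  let q : N.infκPair.carrier → ℚ := fun x => (m₀ x : ℚ) / n₀ x
  have q_eq : ∀ (x : N.infκPair.carrier) (n : ℕ) (a : ℤ) (m : ℕ), 0 < n →
      (x : Kb) ^ n = ι ((RatFunc.C 2) ^ a * s ^ m) → q x = (m : ℚ) / n := by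
    intro x n a m hn h
    have hwd := sDegree_wellDefined (rep₀ x).2 h
    show (m₀ x : ℚ) / n₀ x = m / n
    rw [div_eq_div_iff (Nat.cast_ne_zero.mpr (rep₀ x).1.ne') (Nat.cast_ne_zero.mpr hn.ne')]
    exact_mod_cast hwd
  let c : ℚ → Kb := fun r => ι (RatFunc.C ((2 : ℝ) ^ (r : ℝ)))
  have c_add : ∀ r r' : ℚ, c (r + r') = c r * c r' := by
    intro r r'
    show ι (RatFunc.C ((2 : ℝ) ^ ((r + r' : ℚ) : ℝ))) = ι (RatFunc.C ((2 : ℝ) ^ (r : ℝ))) * ι (RatFunc.C ((2 : ℝ) ^ (r' : ℝ)))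
    rw [Rat.cast_add, Real.rpow_add two_pos, map_mul, map_mul]
  have c_zero : c 0 = 1 := by show ι (RatFunc.C ((2 : ℝ) ^ ((0 : ℚ) : ℝ))) = 1; simp
  have c_fixed : ∀ (g : Γ) (r : ℚ), g • c r = c r := fun g r => hsmul_alg g _
  have c_pow : ∀ (k : ℤ) (n : ℕ), 0 < n → (c ((k : ℚ) / n)) ^ n = ι ((RatFunc.C 2) ^ k) := by
    intro k n hn
    show (ι (RatFunc.C ((2 : ℝ) ^ (((k : ℚ) / n : ℚ) : ℝ)))) ^ n = ι ((RatFunc.C 2) ^ k)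
    rw [← map_pow, ← map_pow, ← Real.rpow_natCast, ← Real.rpow_mul zero_le_two, Rat.cast_div, Rat.cast_intCast,
      Rat.cast_natCast, div_mul_cancel₀ _ (Nat.cast_ne_zero.mpr hn.ne' : (n : ℝ) ≠ 0), Real.rpow_intCast, map_zpow₀]
  have smul_rep : ∀ (f : Kb) (n : ℕ) (a : ℤ) (m : ℕ) (k : ℤ), 0 < n → f ^ n = ι ((RatFunc.C 2) ^ a * s ^ m) →
      (c ((k : ℚ) / n) * f) ^ n = ι ((RatFunc.C 2) ^ (k + a) * s ^ m) := by
    intro f n a m k hn h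
    rw [mul_pow, c_pow k n hn, h, ← map_mul, zpow_add₀ h2, mul_assoc]
  -- representations of `2^{deg} · f` and `2^{−deg} · f` with the SAME `(n, m)`, hence the same degree
  have rep_to : ∀ x : N.infκPair.carrier,
      (c (q x) * (x : Kb)) ^ n₀ x = ι ((RatFunc.C 2) ^ ((m₀ x : ℤ) + a₀ x) * s ^ m₀ x) := fun x => by
    simpa using smul_rep (x : Kb) (n₀ x) (a₀ x) (m₀ x) (m₀ x) (rep₀ x).1 (rep₀ x).2
  have mem_to : ∀ x : N.infκPair.carrier, c (q x) * (x : Kb) ∈ M := fun x =>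
    ⟨n₀ x, m₀ x + a₀ x, m₀ x, (rep₀ x).1, rep_to x⟩
  have rep_inv : ∀ x : N.infκPair.carrier,
      (c (-(q x)) * (x : Kb)) ^ n₀ x = ι ((RatFunc.C 2) ^ (-(m₀ x : ℤ) + a₀ x) * s ^ m₀ x) := fun x => by
    have hq : -(q x) = ((-(m₀ x : ℤ) : ℤ) : ℚ) / n₀ x := by
      show -((m₀ x : ℚ) / n₀ x) = _
      push_cast
      ring
    rw [hq]
    exact smul_rep (x : Kb) (n₀ x) (a₀ x) (m₀ x) (-(m₀ x : ℤ)) (rep₀ x).1 (rep₀ x).2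
  have mem_inv : ∀ x : N.infκPair.carrier, c (-(q x)) * (x : Kb) ∈ M := fun x =>
    ⟨n₀ x, -(m₀ x : ℤ) + a₀ x, m₀ x, (rep₀ x).1, rep_inv x⟩
  have q_to : ∀ x : N.infκPair.carrier, q ⟨c (q x) * (x : Kb), mem_to x⟩ = q x := fun x =>
    q_eq ⟨c (q x) * (x : Kb), mem_to x⟩ (n₀ x) _ (m₀ x) (rep₀ x).1 (rep_to x)
  have q_inv : ∀ x : N.infκPair.carrier, q ⟨c (-(q x)) * (x : Kb), mem_inv x⟩ = q x := fun x =>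
    q_eq ⟨c (-(q x)) * (x : Kb), mem_inv x⟩ (n₀ x) _ (m₀ x) (rep₀ x).1 (rep_inv x)
  have q_smul : ∀ (g : Γ) (x : N.infκPair.carrier), q (g • x) = q x := by
    intro g x
    have h' : ((g • x : N.infκPair.carrier) : Kb) ^ n₀ x = ι ((RatFunc.C 2) ^ a₀ x * s ^ m₀ x) := by
      show (g • (x : Kb)) ^ n₀ x = _
      rw [← smul_pow', (rep₀ x).2, hsmul_alg]
    exact q_eq (g • x) (n₀ x) (a₀ x) (m₀ x) (rep₀ x).1 h'
  have q_mul : ∀ p : N.infκPair.pm.dom, q (N.infκPair.pm.op p) = q p.1.1 + q p.1.2 := by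
    rintro ⟨⟨x, y⟩, hp⟩
    have h' : ((N.infκPair.pm.op ⟨(x, y), hp⟩ : N.infκPair.carrier) : Kb) ^ (n₀ x * n₀ y) =
        ι ((RatFunc.C 2) ^ (a₀ x * n₀ y + a₀ y * n₀ x) * s ^ (m₀ x * n₀ y + m₀ y * n₀ x)) := by
      rw [show ((N.infκPair.pm.op ⟨(x, y), hp⟩ : N.infκPair.carrier) : Kb) = (x : Kb) * y from rfl, mul_pow, pow_mul, (rep₀ x).2, mul_comm (n₀ x) (n₀ y), pow_mul, (rep₀ y).2, ← map_pow ι, ← map_pow ι,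
        ← map_mul ι]
      congr 1
      rw [mul_pow, mul_pow, ← zpow_natCast ((RatFunc.C (2:ℝ)) ^ a₀ x), ← zpow_natCast ((RatFunc.C (2:ℝ)) ^ a₀ y),
        ← zpow_mul, ← zpow_mul, zpow_add₀ h2, pow_add, pow_mul, pow_mul]
      ring
    rw [q_eq _ _ _ _ (mul_pos (rep₀ x).1 (rep₀ y).1) h']
    show ((m₀ x * n₀ y + m₀ y * n₀ x : ℕ) : ℚ) / ((n₀ x * n₀ y : ℕ) : ℚ) = (m₀ x : ℚ) / n₀ x + (m₀ y : ℚ) / n₀ y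
    have hx0 : (n₀ x : ℚ) ≠ 0 := Nat.cast_ne_zero.mpr (rep₀ x).1.ne'
    have hy0 : (n₀ y : ℚ) ≠ 0 := Nat.cast_ne_zero.mpr (rep₀ y).1.ne'
    push_cast
    field_simp
  let e : CoricPair.Iso N.infκPair N.infκPair :=
    { toEquiv :=
        { toFun := fun x => ⟨c (q x) * (x : Kb), mem_to x⟩
          invFun := fun x => ⟨c (-(q x)) * (x : Kb), mem_inv x⟩
          left_inv := fun x => Subtype.ext (by
            show c (-(q ⟨c (q x) * (x : Kb), mem_to x⟩)) * (c (q x) * (x : Kb)) = x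
            rw [q_to x, ← mul_assoc, ← c_add, neg_add_cancel, c_zero, one_mul])
          right_inv := fun x => Subtype.ext (by
            show c (q ⟨c (-(q x)) * (x : Kb), mem_inv x⟩) * (c (-(q x)) * (x : Kb)) = x
            rw [q_inv x, ← mul_assoc, ← c_add, add_neg_cancel, c_zero, one_mul]) }
      smul := fun g x => Subtype.ext (by
        show c (q (g • x)) * (g • (x : Kb)) = g • (c (q x) * (x : Kb))
        rw [q_smul g x, smul_mul', c_fixed])
      dom := fun p => iff_of_true (mul_memM p.1.2 p.2.2) (mul_memM (mem_to p.1) (mem_to p.2))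
      op := fun p => Subtype.ext (by
        show c (q (N.infκPair.pm.op p)) * ((p.1.1 : Kb) * p.1.2) = (c (q p.1.1) * (p.1.1 : Kb)) * (c (q p.1.2) * p.1.2)
        rw [q_mul p, c_add]
        ring) }
  -- it is not the identity: it moves `s` to `2 s`
  have hne : e ≠ CoricPair.Iso.refl N.infκPair := by
    intro he
    let x₀ : N.infκPair.carrier := ⟨ι s, s_mem⟩
    have hq₀ : q x₀ = 1 := by
      simpa using q_eq x₀ 1 0 1 one_pos (by show (ι s) ^ 1 = ι ((RatFunc.C 2) ^ (0 : ℤ) * s ^ 1); simp)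
    have hval : ((e.toEquiv x₀ : N.infκPair.carrier) : Kb) = ι (RatFunc.C 2) * ι s := by
      show ι (RatFunc.C ((2 : ℝ) ^ ((q x₀ : ℚ) : ℝ))) * ι s = _
      rw [hq₀, Rat.cast_one, Real.rpow_one]
    rw [he] at hval
    change ι s = ι (RatFunc.C 2) * ι s at hval
    have h3 : ι (RatFunc.C 2) = 1 := (mul_eq_right₀ ((_root_.map_ne_zero ι).mpr hs)).mp hval.symm
    have h4 : RatFunc.C (2 : ℝ) = RatFunc.C 1 := hι (by rw [h3, map_one, map_one])
    exact absurd ((RatFunc.C : ℝ →+* RatFunc ℝ).injective h4) (by norm_num)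
  have hEU : ¬ ExistsUniqueCoricStructure N.piRat N.infκPair := fun h => hne (h.subsingleton_iso.elim _ _)
  -- (7) law (iv) fails: contraposition of the field-level closer p436822
  have hdiv : ¬ (∀ (H : OpenNormalSubgroup N.piRat) (a : N.Krat), a ≠ 0 → (∀ h : N.piRat, h ∈ H → h • a = a) →
      (∀ n : ℕ+, ∃ b : N.Krat, (∀ h : N.piRat, h ∈ H → h • b = b) ∧ b ^ (n : ℕ) = a) → a = 1) := fun hdiv =>
    hEU (N.existsUniqueCoricStructure_infκPair_fieldLevel hroot hprim h1 hpow hdiv ord hordmul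
      (fun f' hf' hfix' => hpole f' (N.minfκ_subset hf') hfix') hex)
  exact ⟨N, ord, hroot, hprim, h1, hpow, hordmul, hpole, hex, hMκ, hEU, fun h => hne (h.subsingleton_iso.elim _ _), hdiv⟩

/-- **Corollary (refuted strengthening).**  The field-level closer with law (iv) DELETED is FALSE as a schema over the Example
5.1 (i) interface: `hroot hprim h1 hpow hordmul hpole hex` do not imply `ExistsUniqueCoricStructure π₁^rat 𝕄^⊛_∞κ`.  (iv) — no
invariant infinitely divisible element `≠ 1`, in print a consequence of the constant field being a NUMBER FIELD — is where the
arithmetic enters "uniquely determined isomorphism". ([IUTchI] Ex 5.1 (v) p.128) [claim: Mochizuki2012, status: disputed] -/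
theorem not_fieldLevel_sans_div :
    ¬ ∀ (N : NFBridgeRecon.{0}) (ord : Fin 2 → N.Krat → ℤ),
      (∀ a : N.Krat, a ≠ 0 → ∀ n : ℕ, 0 < n → ∃ b : N.Krat, b ^ n = a) →
      (∀ n : ℕ, 0 < n → ∃ ζ : N.Krat, IsPrimitiveRoot ζ n) →
      (1 : N.Krat) ∈ N.Minfκ →
      (∀ (f : N.Krat) (n : ℕ), 0 < n → (f ∈ N.Minfκ ↔ f ^ n ∈ N.Minfκ)) →
      (∀ (x : Fin 2) (a b : N.Krat), a ≠ 0 → b ≠ 0 → (∀ g : N.piRat, g • a = a) → (∀ g : N.piRat, g • b = b) →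
        ord x (a * b) = ord x a + ord x b) →
      (∀ f' ∈ N.Minfκx, (∀ g : N.piRat, g • f' = f') →
        ∀ x₁ x₂ : Fin 2, x₁ ≠ x₂ → ¬ (ord x₁ f' < 0 ∧ ord x₂ f' < 0)) →
      (∃ f ∈ N.Minfκ, (∀ g : N.piRat, g • f = f) ∧ ∃ x₁ x₂ : Fin 2, x₁ ≠ x₂ ∧ 0 < ord x₁ f ∧ 0 < ord x₂ f) →
      ExistsUniqueCoricStructure N.piRat N.infκPair := by
  intro h
  obtain ⟨N, ord, hroot, hprim, h1, hpow, hordmul, hpole, hex, -, hEU, -, -⟩ :=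
    exists_fieldLevel_laws_sans_div_not_existsUniqueCoricStructure
  exact hEU (h N ord hroot hprim h1 hpow hordmul hpole hex)

end NFBridgeRecon
end Literature.IUT.HodgeTheaters
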